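import Summits.FinalStateConjecture.FinalStateConjecture.Theses.StarvedNecks
import Summits.FinalStateConjecture.FinalStateConjecture.Theses.SwallowTheDatum
import Summits.FinalStateConjecture.FinalStateConjecture.Theorems.SwallowTheDatumUniversalWitnessFamilySheetLine
import Summits.FinalStateConjecture.FinalStateConjecture.Theorems.SwallowTheDatumUniversalWitnessFamilySheetLineReduction
import Summits.FinalStateConjecture.FinalStateConjecture.Theorems.SwallowTheDatumUniversalWitnessFamilyRegionOneAssembly
import Summits.FinalStateConjecture.FinalStateConjecture.Theorems.HonestFixedRadiusSettling.Negative.KillShape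
import Summits.FinalStateConjecture.FinalStateConjecture.Theorems.StarvedNecksHonestFixedRadiusSettlingStubRegionOneHoleClauses
import Summits.FinalStateConjecture.FinalStateConjecture.Theorems.StarvedNecksHonestFixedRadiusSettlingStubHonestPushforward
import Summits.FinalStateConjecture.FinalStateConjecture.Theorems.StarvedNecksHonestFixedRadiusSettlingStubNoFutureAccumulation
import Summits.FinalStateConjecture.FinalStateConjecture.Theorems.StarvedNecksHonestFixedRadiusSettlingStubSheetProper
import Summits.FinalStateConjecture.FinalStateConjecture.Theorems.StarvedNecksHonestFixedRadiusSettlingStubFarSlabNoEscape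
import Summits.FinalStateConjecture.FinalStateConjecture.Theorems.StarvedNecksHonestFixedRadiusSettlingStubRegionOneFlatClauses
import Summits.FinalStateConjecture.FinalStateConjecture.Theorems.StarvedNecksHonestFixedRadiusSettlingStubRegionOneFarCloseness
import Literature.Geometry.Lorentzian.CauchyDevelopmentGlobalHyperbolicityProofs
import Literature.Geometry.Lorentzian.CausalCurveLengthBound
import HarnessLib.Audit

/-!
# Line `far-field-surgery` (reshape v6, lead c2) — crux `StarvedNecks.HonestFixedRadiusSettling`
# (stmt-FinalStateConjecture-13550): the SHEET-BURIAL composition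

Lead c2, 2026-08-16.  The line's idea is unchanged (B1: every witness curve of the crux must alter the far
field; alter it by GLUING; push what is left into statements about glued data), and so is its first atom
A″ = `Theses.SwallowTheDatum.FarAnnulusGluing` (item stmt-FinalStateConjecture-15427, BY NAME).  Leads c1's open
cores D′/D″ ("far-glued data SETTLE") are replaced by a SECOND SURGERY after which nothing dynamical is left:
the Schwarzschild(`m R ≥ ηR`)-ended far-glued datum is plugged into the UNIVERSAL SOCKET BAG of route
SwallowTheDatum (`Theses.SwallowTheDatum.UniversalSocketBag`, item 15426, BY NAME) — the SHEET BURIAL, whose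
d-side plumbing is LANDED and property-independent
(`Theorems.SwallowTheDatum.UniversalWitnessFamily.SheetLine.sheetBurial_of`): through every admissible `d` passes a
smooth injective admissible curve `F`, `F 0 = d`, whose members off `c = 0` are SHEET-SHIELDED (outside a compact
set the member IS the time-symmetric isotropic Schwarzschild exterior sheet `{‖y‖ > M'/2}`).  In every MGHD of a
sheet-shielded member the domain of outer communications is Kruskal REGION I over the sheet
(`Theses.SwallowTheDatum.MGHDExists` 9937 + `Theses.SwallowTheDatum.SubdataDevelopmentsEmbed` 10053, BY NAME; the
region-I development, its Cauchy property, `stub_exteriorTransport` and the scri lever `stub_scriTransfer` are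
LANDED), so the crux's pointwise property `P` (= `Negative.settlingSet`: MGHD ∧ ∀ MGHD, complete `𝓘⁺` ∧ HONEST `C⁴`
decomposition) holds there DETERMINISTICALLY once:

* (R) region I carries an HONEST `C⁴` `N = 1` decomposition — the landed `C²` exhaustive decomposition of
  `…RegionOneAssembly.stub_regionOneDecomposition` (hole chart `holeMap`, flat chart `outMap`) read at `k = 4`
  (its deviation lemmas are order-free) plus the seven honest clauses: stubs `stub_regionOneHoleClauses`
  (Hc.2 anchoring by the static Killing flow, Hc.3 closedness of late tube portions), `stub_regionOneFlatClauses`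
  (Hc.4 `dΦ(∂₀) = ∂_{t*}` future, Hf.1 flat-late points below later flat slabs along the half-speed outgoing curve,
  Hf.2 far flat slabs closed), `stub_regionOneFarCloseness` (Hf.3: `C⁰` deviation of the `t*`-bent hole chart
  `≤ 1/10` beyond `100M`, late);
* (T) the clauses TRANSPORT along the isometric open embedding `χ` of region I into the MGHD
  (`stub_honestPushforward`, generic bookkeeping: deviations are identical, causal pasts and future-directed
  vectors push forward, RELATIVE closures commute with `χ`), except that Hf.2 is an ABSOLUTE closure in the MGHD
  and needs NO ACCUMULATION of the far flat slabs at the Cauchy horizon of `χ(region I)`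
  (`stub_farSlabNoEscape`, a dichotomy): escape to spatial infinity is excluded by `stub_sheetProper` (sheet shields
  are proper at infinity: a Riemannian-isometric open embedding of the sheet cannot let far points accumulate in
  `X` — chart-ball packing), escape to timelike infinity by `stub_noFutureAccumulation` (static world-lines of
  bounded radius have arc length `∝ t → ∞`, while causal curves inside the compact `J⁺(Σ) ∩ J⁻(z⁺)` of a Cauchy
  development have bounded length: `CauchyDevelopment.isCompact_causalPast_inter_causalFuture_range`,
  `CauchyDevelopment.isStronglyCausal`, `IsStronglyCausal.exists_arcLength_le_of_isCompact`, all in the tree).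

Composition (this file, sorry-free outside the seven `stub_*`): `regionOneHonestDecomposition` (R + the
no-escape certificate), `settlesHonestly_core` / `settlesHonestlyInEveryMGHD_ofSheet` (T, over the landed plumbing
of `…ThroatSettlesToo.settles_core`), `sheetShieldedSettlesHonestly`, and
`HonestFixedRadiusSettling_of : FarAnnulusGluing → UniversalSocketBag → MGHDExists → SubdataDevelopmentsEmbed →
(7 stubs) → HonestFixedRadiusSettling` (genericity plumbing through `Negative.crux_iff`).  OUTCOME WHEN THE STUBS
LAND: the crux is closed MODULO the four EXISTING SwallowTheDatum items {15427, 15426, 9937, 10053} — the honest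
clauses do not close the typed-genericity loophole (Disproof v6 §8e.6 remarked it; this line certifies it).

STATUS (lead c2, 2026-08-16T21:30Z): ALL SEVEN STUBS LANDED — 1 `stub_sheetProper` p123888 (lead), 2
`stub_noFutureAccumulation` p123669, 3 `stub_regionOneHoleClauses` p123475, 4 `stub_regionOneFlatClauses` p124034, 5
`stub_regionOneFarCloseness` p124203 (+ `…Aux` p123978), 6 `stub_honestPushforward` p123640, 7 `stub_farSlabNoEscape` p123969
(`Theorems/StarvedNecksHonestFixedRadiusSettlingStub*.lean`, namespace `…Theorems.StarvedNecks.SheetBurial`); the `stub_*`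
theorems below are the landed decls, so this file is sorry-free and `HonestFixedRadiusSettling_of` is the crux MODULO the four
SwallowTheDatum items.  Tree twin of the composition: `Theorems/StarvedNecksHonestFixedRadiusSettlingSheetBurialRegionOne.lean` +
`…SheetBurialLine.lean` (`honestFixedRadiusSettling_of_sheetAtoms`, `--supports` 13550, CONDITIONAL).

Disproof used (v6, re-read 2026-08-16T19Z): §1 kill shape (families only `C^∞_loc`-controlled — the surgery IS
the receding modification), §7/§8c (maximality guard load-bearing: every statement keeps `𝒟.IsMaximal →`; region I
enters only through `SubdataDevelopmentsEmbed` applied to a MAXIMAL `𝒟`), §8e.1 (rest-frame class: the end is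
unboosted Schwarzschild, motion `(1, 0)`), §8e.6 (crux ⇐ burial); no `_false_without_` theorem or `-- Targets`
section exists.  Earlier skeletons: v1–v5 (`Lines/far_field_surgery.lean` history, leads c1): stubs B p116096,
C p116598 landed; reductions p117120, p121008; breathing probe p121325.
-/

set_option linter.dupNamespace false

noncomputable section

namespace Summit.FinalStateConjecture.FinalStateConjecture.Cruxes.HonestFixedRadiusSettling.SheetBurial

open scoped Manifold ContDiff Topology
open Set Filter Function Literature.Geometry.Lorentzian
open Summit.FinalStateConjecture.FinalStateConjecture.Theses.StarvedNecks (HonestFixedRadiusSettling)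
open Summit.FinalStateConjecture.FinalStateConjecture.Theses.SwallowTheDatum
  (FarAnnulusGluing UniversalSocketBag MGHDExists SubdataDevelopmentsEmbed)
open Summit.FinalStateConjecture.FinalStateConjecture.Theorems.HonestFixedRadiusSettling.Negative
  (settlingSet honestCoreSet honestFarSet honestDevelopments crux_iff)
open Summit.FinalStateConjecture.FinalStateConjecture.Theorems.SwallowTheDatum.UniversalWitnessFamily
  (torH staticTime excision exactRadius bend holeMap outMap vert ksTime)
open Summit.FinalStateConjecture.FinalStateConjecture.Theorems.SwallowTheDatum.ParametricKerrBurial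
  (SmoothSectionsOn AgreeAt IsExactSchwarzschildBeyond IsSchwarzschildAnnulus VacuumOn IsIsotropicBeyond)

/-! ## §1 The seven registered stubs -/

/-- **Stub 1 — `stub_sheetProper` (SHEET SHIELDS ARE PROPER AT INFINITY).**  If `Φ : {‖y‖ > M'/2} → X` is a
smooth open embedding with injective differentials along which the datum `D` pulls back EXACTLY to the
time-symmetric isotropic Schwarzschild exterior data (`Φ^* h = (1 + M'/2‖y‖)⁴ δ ≥ δ`), then `Φ(y)` leaves every
compact subset of `X` as `‖y‖ → ∞`.  Intended proof (no volume, no completeness): if `Φ(yₙ) → k` with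
`‖yₙ‖ → ∞`, then (`Φ` a Riemannian isometry onto its open image, `h` continuous at `k`, extended chart `φ` at `k`
with `‖dφ‖, ‖dφ⁻¹‖` bounded near `k`: Mathlib `eventually_norm_mfderiv_extChartAt_lt` /
`eventually_norm_mfderivWithin_symm_extChartAt_lt`, or the tree's `PseudoRiemannianMetric.edist` API of
`Literature/Geometry/Riemannian/RiemannianDistance.lean`) the images `Wₙ = Φ(B(yₙ, ρ))` of small sheet balls lie in
the chart domain (paths from `Φ yₙ` of `h`-length `≤ 4ρ` cannot reach its boundary), `cl Wₙ = Φ(cl B) ⊆ range Φ`,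
and `φ(Wₙ)` contains the Euclidean ball `B(φ Φ yₙ, ρ/2C)` (lift the segment through the local inverse of the local
diffeomorphism `φ ∘ Φ`, whose inverse differential is bounded by the metric comparison); for `‖yₙ − yₘ‖ ≥ 2ρ` these
balls are disjoint while their centres converge — contradiction. [folklore] -/
theorem stub_sheetProper :
    ∀ (X : Type) [TopologicalSpace X] [ChartedSpace E3 X] [IsManifold (𝓡 3) ∞ X] [T2Space X]
      (D : InitialDataSet (𝓡 3) X) (M' : ℝ) (hM' : 0 < M') (Φ : Schwarzschild.isotropicExterior M' → X)
      (hΦ : ContMDiff (𝓡 3) (𝓡 3) (∞ + 1) Φ) (hΦ' : ∀ u, Function.Injective (mfderiv (𝓡 3) (𝓡 3) Φ u)),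
      Topology.IsOpenEmbedding Φ →
      D.comap Φ hΦ hΦ' = Schwarzschild.timeSymmetricExteriorData M' hM'.le →
      ∀ K : Set X, IsCompact K →
        ∃ R' : ℝ, ∀ y : Schwarzschild.isotropicExterior M', R' < ‖(y : E3)‖ → Φ y ∉ K :=
  -- LANDED: `Theorems/StarvedNecksHonestFixedRadiusSettlingStubSheetProper.lean` (p123888)
  Summit.FinalStateConjecture.FinalStateConjecture.Theorems.StarvedNecks.SheetBurial.stub_sheetProper

/-- **Stub 2 — `stub_noFutureAccumulation` (STATIC WORLD-LINES OF BOUNDED RADIUS DO NOT ACCUMULATE IN A CAUCHY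
DEVELOPMENT).**  Let `χ` embed the Schwarzschild exterior `Kerr.spacetime M 0 (2M)` (region I) isometrically,
openly and time-orientedly into a Cauchy development `𝒟`, mapping the static slice `{t = 0}` into the Cauchy
hypersurface `ι(X)`.  If `pₙ` are points of region I with radii in `[r₁, r₂]`, `r₁ > 2M`, and static times
`t(pₙ) → +∞`, then `χ(pₙ)` has no limit in `𝒟`.  Intended proof: if `χ pₙ → z`, pick `z⁺ ∈ I⁺(z)`; eventually
`χ pₙ ∈ I⁻(z⁺)`; the vertical (static Killing) segment from the slice point `pₙ − t(pₙ) e₀` to `pₙ` is a future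
timelike curve of arc length `t(pₙ) √(1 − 2M/rₙ) ≥ t(pₙ) √(1 − 2M/r₁) → ∞` (`isFutureTimelikeCurveOn_vert`,
`kerr_bilin_basisVector_zero_self`), its `χ`-image is a causal curve of the SAME arc length (isometric immersion)
inside the compact set `J⁺(ι X) ∩ J⁻(z⁺)` (`CauchyDevelopment.isCompact_causalPast_inter_causalFuture_range`),
contradicting the uniform length bound of `LorentzianMetric.IsStronglyCausal.exists_arcLength_le_of_isCompact`
(`CauchyDevelopment.isStronglyCausal`). [cite: ONeillSemiRiemannian1983, Ch. 14, Lemma 14.13–14.14]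
[cite: HawkingEllis1973CUP, §6.6, Prop. 6.6.6] -/
theorem stub_noFutureAccumulation :
    ∀ [Kerr.Facts] (M : ℝ) (hM : 0 < M)
      (X : Type) [TopologicalSpace X] [ChartedSpace E3 X] [IsManifold (𝓡 3) ∞ X]
      [T2Space X] [SecondCountableTopology X] [ConnectedSpace X]
      (D : InitialDataSet (𝓡 3) X) (𝒟 : CauchyDevelopment D)
      (χ : (Kerr.spacetime M 0 (Kerr.rPlus M 0) hM.le).carrier → 𝒟.carrier),
      ContMDiff (𝓡 4) (𝓡 4) ∞ χ → Topology.IsOpenEmbedding χ →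
      (Kerr.spacetime M 0 (Kerr.rPlus M 0) hM.le).metric.IsIsometricImmersion
        𝒟.metric.toPseudoRiemannianMetric χ →
      (Kerr.spacetime M 0 (Kerr.rPlus M 0) hM.le).timeOrientation.PreservesTimeOrientation χ
        𝒟.timeOrientation →
      χ '' {p | staticTime M p.1 = 0} ⊆ Set.range 𝒟.embed →
      ∀ (p : ℕ → Kerr.region 0 (Kerr.rPlus M 0)) (r₁ r₂ : ℝ), 2 * M < r₁ →
        (∀ n, r₁ ≤ E4.spatialNorm (p n).1 ∧ E4.spatialNorm (p n).1 ≤ r₂) →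
        Tendsto (fun n ↦ staticTime M (p n).1) atTop atTop →
        ∀ z : 𝒟.carrier, ¬ Tendsto (fun n ↦ χ (p n)) atTop (𝓝 z) :=
  -- LANDED: `Theorems/StarvedNecksHonestFixedRadiusSettlingStub….lean`
  Summit.FinalStateConjecture.FinalStateConjecture.Theorems.StarvedNecks.SheetBurial.stub_noFutureAccumulation

/-- **Stub 3 — `stub_regionOneHoleClauses` (Hc.2 ANCHORING and Hc.3 CLOSED LATE TUBE PORTIONS for the `t*`-bent
hole chart `holeMap M T₀` of region I).**  With `B = boostedKerrBackground 1 0 M 0` (time `y⁰`, radius `‖ỹ‖`,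
domain `{‖ỹ‖ > 2M}`) and the hole chart `Ψ y = holeMap M T₀ y = (y⁰ + bend M y⁰ ‖ỹ‖, ỹ)` on `{y⁰ ≥ T₀ + 1}`
(`holeMap_of_le`, `bentMap_apply_zero`): (Hc.2) a hole-late image point with `T₀ + 1 < y⁰ < τ₂`, `‖ỹ‖ < ϱ` lies in
the causal past of the image of the truncated slab `{y⁰ = τ₂, ‖ỹ‖ ≤ ϱ}` — same spatial point, later Kerr–Schild
time since `t ↦ t + bend M t r` is strictly increasing on `[T₀, ∞)` (`strictMonoOn_add_bend`), joined by the
vertical static orbit (`mem_causalPast_vert`); (Hc.3) for `τ' > T₀ + 1` and continuous `ϱ` the image of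
`{τ' ≤ y⁰, ‖ỹ‖ ≤ ϱ(y⁰)}` is CLOSED in region I: along a convergent sequence of image points the chart times `yₙ⁰`
are bounded (`bend ≥ 0`: `yₙ⁰ ≤` the convergent Kerr–Schild times) and `≥ τ'`, so a subsequence converges in the
closed coordinate set and continuity of `holeMap` on `{‖ỹ‖ > 2M}` identifies the limit as an image point.
[folklore] -/
theorem stub_regionOneHoleClauses :
    ∀ [Kerr.Facts] (M : ℝ) (hM : 0 < M) (T₀ : ℝ),
      (∀ t r : ℝ, T₀ ≤ t → 2 * M < r → |deriv (fun t ↦ bend M t r) t| ≤ 1 / 2) →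
      ∀ (Ψ : (boostedKerrBackground 1 0 M 0).domain → Kerr.region 0 (Kerr.rPlus M 0)),
      (∀ y, (Ψ y : E4) = holeMap M T₀ y) →
      (∀ (ϱ τ₂ : ℝ), T₀ + 1 < τ₂ →
        Ψ '' {x | T₀ + 1 < (boostedKerrBackground 1 0 M 0).time x.1 ∧
            (boostedKerrBackground 1 0 M 0).time x.1 < τ₂ ∧ (boostedKerrBackground 1 0 M 0).radius x.1 < ϱ} ⊆
          (Kerr.smoothMetric M 0 (Kerr.rPlus M 0)).causalPast (ksTime hM.le)
            (Ψ '' (boostedKerrBackground 1 0 M 0).truncTimeSlab ϱ τ₂)) ∧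
      (∀ (τ' : ℝ) (ϱ : ℝ → ℝ), Continuous ϱ → T₀ + 1 < τ' →
        closure (Ψ '' {x | τ' ≤ (boostedKerrBackground 1 0 M 0).time x.1 ∧
            (boostedKerrBackground 1 0 M 0).radius x.1 ≤ ϱ ((boostedKerrBackground 1 0 M 0).time x.1)}) ⊆
          Ψ '' {x | τ' ≤ (boostedKerrBackground 1 0 M 0).time x.1 ∧
            (boostedKerrBackground 1 0 M 0).radius x.1 ≤ ϱ ((boostedKerrBackground 1 0 M 0).time x.1)}) :=
  -- LANDED: `Theorems/StarvedNecksHonestFixedRadiusSettlingStub….lean`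
  Summit.FinalStateConjecture.FinalStateConjecture.Theorems.StarvedNecks.SheetBurial.stub_regionOneHoleClauses

/-- **Stub 4 — `stub_regionOneFlatClauses` (Hc.4, Hf.1, Hf.2 for the outgoing Kerr–Schild flat chart `outMap M`
of region I).**  With `U = {x⁰ > T₀ + 1, ‖x̃‖ > excision M x⁰}` and `Φ y = outMap M y = (y⁰ + 2 torH M ‖ỹ‖, ỹ)`:
(Hc.4) `dΦ(e₀) = e₀` (`fderiv_outMap_apply`, `E4.spatial e₀ = 0`) is future timelike on region I
(`kerr_bilin_basisVector_zero_self`, `Kerr.bilin_timeVector`); (Hf.1) a flat point with `T₀ + 1 < y⁰ < τ₂` lies in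
the causal past of the flat slab `{y⁰ = τ₂}`: follow the half-speed outgoing curve
`s ↦ Φ(y⁰ + s, ỹ (1 + s/2‖ỹ‖))`, which is future timelike (`g = −1/2 − (r − 2M)/4r < 0` in the closed form of
`kerr_bilin_zero_spin_self`) and stays in `U` because `τ ↦ excision M τ` is `1/2`-Lipschitz (`hasDerivAt_growth`:
`|ρ'| ≤ sup (u/2)(1+u²)^{-3/4} < 0.32`); (Hf.2) for `τ' > T₀ + 1` the image of the far slab
`{τ' ≤ y⁰, excision M y⁰ + 1 ≤ ‖ỹ‖}` is closed in region I and consists of flat points with `y⁰ ≥ τ'` (invert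
`outMap` by `y⁰ = p⁰ − 2 torH ‖p̃‖`, continuity of `torH` on `{r > 2M}` and of `excision`). [folklore] -/
theorem stub_regionOneFlatClauses :
    ∀ [Kerr.Facts] (M : ℝ) (hM : 0 < M) (T₀ : ℝ), 0 ≤ T₀ →
      ∀ (U : TopologicalSpace.Opens E4),
      (∀ x, x ∈ U ↔ T₀ + 1 < x 0 ∧ excision M (x 0) < E4.spatialNorm x) →
      ∀ (Φ : (Minkowski.backgroundOn U).domain → Kerr.region 0 (Kerr.rPlus M 0)),
      (∀ y, (Φ y : E4) = outMap M y) →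
      (∀ y : (Minkowski.backgroundOn U).domain, T₀ + 1 < y.1 0 →
        (ksTime hM.le).IsFutureDirected
          (mfderiv 𝓘(ℝ, E4) 𝓘(ℝ, E4) Φ y (E4.basisVector 0))) ∧
      (∀ τ₂ : ℝ, T₀ + 1 < τ₂ →
        Φ '' {y | T₀ + 1 < y.1 0 ∧ y.1 0 < τ₂} ⊆
          (Kerr.smoothMetric M 0 (Kerr.rPlus M 0)).causalPast (ksTime hM.le)
            (Φ '' (Minkowski.backgroundOn U).timeSlab τ₂)) ∧
      (∀ τ' : ℝ, T₀ + 1 < τ' →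
        closure (Φ '' {y | τ' ≤ y.1 0 ∧ excision M (y.1 0) + 1 ≤ E4.spatialNorm y.1}) ⊆
          Φ '' {y | τ' ≤ y.1 0}) :=
  -- LANDED: `Theorems/StarvedNecksHonestFixedRadiusSettlingStubRegionOneFlatClauses.lean` (p124034)
  Summit.FinalStateConjecture.FinalStateConjecture.Theorems.StarvedNecks.SheetBurial.stub_regionOneFlatClauses

/-- **Stub 5 — `stub_regionOneFarCloseness` (Hf.3: THE BENT HOLE CHART IS `C⁰`-CLOSE TO SCHWARZSCHILD BEYOND `100M`,
LATE).**  For the hole chart `Ψ y = holeMap M T₀ y` the `C⁰` sup norm of the deviation `Ψ^* g − g_{M,0}` over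
`{y⁰ ≥ T, ‖ỹ‖ ≥ 100M}` is at most `1/10` for `T` large.  Intended proof: on `{y⁰ ≥ T₀ + 1}`,
`Ψ = bentMap M : y ↦ y + β(y⁰, ‖ỹ‖) e₀`, `β = bend M`, and `g_{M,0}` is stationary, so
`(Ψ^*g − g)(v, w) = dβ(v) g(e₀, w) + dβ(w) g(v, e₀) + dβ(v) dβ(w) g(e₀, e₀)` with
`dβ = β_t dt + β_r dr`; `|β_r| ≤ 2M/(r − 2M) χ + (torH r / S(t)) |χ'| ≤ 1/49 + o(1)` on `{r ≥ 100M}` (transition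
zone `S ≤ r ≤ 2S`, `torH(2S)/S → 0`, `exists_bound_deriv_smoothTransition`), `|β_t| ≤ C torH(2S(t))/t → 0`
(`abs_deriv_bend_t_le`), `‖g(e₀, ·)‖ ≤ 1.06`, `|g(e₀, e₀)| ≤ 1` there (`kerr_bilin_zero_spin`); hence operator norm
`≤ 2·(0.03)(1.06) + 0.001 < 1/10` once `T` is large. (Card bury-it-honestly numerics: sup `C⁰` dev `0.020`.)
[folklore] -/
theorem stub_regionOneFarCloseness :
    ∀ [Kerr.Facts] (M : ℝ) (hM : 0 < M) (T₀ : ℝ)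
      (Ψ : (boostedKerrBackground 1 0 M 0).domain → Kerr.region 0 (Kerr.rPlus M 0)),
      (∀ y, (Ψ y : E4) = holeMap M T₀ y) →
      ∃ T : ℝ, supCkENorm (Subtype.val '' {x : (boostedKerrBackground 1 0 M 0).domain |
          T ≤ (boostedKerrBackground 1 0 M 0).time x.1 ∧ 100 * M ≤ (boostedKerrBackground 1 0 M 0).radius x.1})
        0 ((Kerr.spacetime M 0 (Kerr.rPlus M 0) hM.le).deviationExtend (boostedKerrBackground 1 0 M 0) Ψ) ≤
        ENNReal.ofReal (1 / 10) :=
  -- LANDED: `Theorems/StarvedNecksHonestFixedRadiusSettlingStubRegionOneFarCloseness.lean` (p124203)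
  Summit.FinalStateConjecture.FinalStateConjecture.Theorems.StarvedNecks.SheetBurial.stub_regionOneFarCloseness

/-- **Stub 6 — `stub_honestPushforward` (HONEST DECOMPOSITIONS PUSH FORWARD ALONG ISOMETRIC OPEN EMBEDDINGS).**
`χ : 𝓢 → 𝓢'` smooth, open embedding, isometric, time-orientation preserving; `d` a `Cᵏ` decomposition of
`O ⊆ 𝓢` in `honestCoreSet ∩ honestFarSet` at radius `R₀`; and NO ESCAPE of the far flat slabs
(`closure (χ(Φ(far slab τ'))) ⊆ range χ` for every `τ' > τ₀`).  Then `χ_* d` (same holes, motions, `τ₀`, excision,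
flat domain; charts `χ ∘ chartᵢ`, `χ ∘ flatChart` — verbatim the landed
`SwallowTheDatum.UniversalWitnessFamily.stub_decompositionPushforward` at order `k`) is a `Cᵏ` decomposition of
`χ(O)` with charted region `χ(d.charted)`, again in `honestCoreSet ∩ honestFarSet` at `R₀`: deviations are
IDENTICAL (`deviationExtend_comp`), causal pasts push forward (`LorentzianMetric.image_causalPast_subset`),
`d(χ ∘ Φ)(e₀) = dχ(dΦ e₀)` is future-directed (`PreservesTimeOrientation` + chain rule: a future-directed causal
vector maps to one, `TimeOrientation.IsFutureDirected` is `IsCausal ∧ g(T, ·) < 0`, transported by the isometry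
and the connectedness-of-timecone argument of `IsometryProofs`), relative closures commute with the open embedding
(`closure (χ A) ∩ range χ = χ (closure A)`), and Hf.2 uses the no-escape hypothesis. [folklore] -/
theorem stub_honestPushforward :
    ∀ (𝓢 𝓢' : Spacetime.{0} 4) (χ : 𝓢.carrier → 𝓢'.carrier),
      ContMDiff (𝓡 4) (𝓡 4) ∞ χ → Topology.IsOpenEmbedding χ →
      𝓢.metric.IsIsometricImmersion 𝓢'.metric.toPseudoRiemannianMetric χ →
      𝓢.timeOrientation.PreservesTimeOrientation χ 𝓢'.timeOrientation →
      ∀ (O : Set 𝓢.carrier) (k : ℕ) (d : FinalStateDecomposition 𝓢 O k) (R₀ : ℝ),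
        d ∈ honestCoreSet 𝓢 O k R₀ → d ∈ honestFarSet 𝓢 O k R₀ →
        (∀ τ' : ℝ, d.τ₀ < τ' →
          closure (χ '' (d.flatChart '' {y | τ' ≤ y.1 0 ∧
            ∀ i, d.excision i (y.1 0) + 1 ≤ (d.background i).radius y.1})) ⊆ Set.range χ) →
        ∃ d' : FinalStateDecomposition 𝓢' (χ '' O) k,
          d'.charted = χ '' d.charted ∧
          d' ∈ honestCoreSet 𝓢' (χ '' O) k R₀ ∧ d' ∈ honestFarSet 𝓢' (χ '' O) k R₀ :=
  -- LANDED: `Theorems/StarvedNecksHonestFixedRadiusSettlingStub….lean`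
  Summit.FinalStateConjecture.FinalStateConjecture.Theorems.StarvedNecks.SheetBurial.stub_honestPushforward

/-- **Stub 7 — `stub_farSlabNoEscape` (NO ACCUMULATION OF THE FAR FLAT SLABS OF REGION I AT THE CAUCHY HORIZON),
the dichotomy.**  Flat chart `Φ y = outMap M y` on `U = {x⁰ > T₀ + 1, ‖x̃‖ > excision M x⁰}`; `χ` an isometric
time-oriented open embedding of region I into a Cauchy development `𝒟` over the sheet (`χ ∘ ψ = ι ∘ Φ'`);
PROPERNESS of `Φ'` (conclusion of stub 1) and NO FUTURE ACCUMULATION (conclusion of stub 2) as hypotheses.  Then for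
`τ' > T₀ + 1` every limit in `𝒟` of points `χ(Φ yₙ)`, `τ' ≤ yₙ⁰`, `excision M yₙ⁰ + 1 ≤ ‖ỹₙ‖`, lies in
`range χ`.  Intended proof, three cases: (i) `‖ỹₙ‖` and `yₙ⁰` bounded — the `Φ yₙ` lie in a compact subset of region
I (`‖x̃‖ ∈ [excision M τ' + 1, R]`, bounded Kerr–Schild time), a subsequence converges there, continuity of `χ`;
(ii) `‖ỹₙ‖ → ∞` — the static-slice foot point below `Φ yₙ` (`vert_neg_staticTime_mem_range`: `= ψ wₙ`, areal
radius `‖ỹₙ‖ = ‖wₙ‖(1 + M/2‖wₙ‖)² ≤ 4‖wₙ‖`) satisfies `ι(Φ' wₙ) = χ(ψ wₙ) ∈ J⁻(χ Φ yₙ) ⊆ J⁻(z⁺)`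
(`mem_causalPast_vert`, `LorentzianMetric.image_causalPast_subset`), so `Φ' wₙ` stays in the compact
`ι⁻¹(J⁻(z⁺) ∩ J⁺(ι X))` (`CauchyDevelopment.isCompact_causalPast_inter_causalFuture_range`, `ι` an embedding with
closed range) — contradicting properness; (iii) `‖ỹₙ‖` bounded, `yₙ⁰ → ∞` — static time
`t(Φ yₙ) = yₙ⁰ + torH ‖ỹₙ‖ → ∞` at bounded radius, excluded by the no-accumulation hypothesis. [folklore] -/
theorem stub_farSlabNoEscape :
    ∀ [Kerr.Facts] (M : ℝ) (hM : 0 < M) (T₀ : ℝ), 0 ≤ T₀ →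
      ∀ (U : TopologicalSpace.Opens E4),
      (∀ x, x ∈ U ↔ T₀ + 1 < x 0 ∧ excision M (x 0) < E4.spatialNorm x) →
      ∀ (Φ : (Minkowski.backgroundOn U).domain → Kerr.region 0 (Kerr.rPlus M 0)),
      (∀ y, (Φ y : E4) = outMap M y) →
      ∀ (X : Type) [TopologicalSpace X] [ChartedSpace E3 X] [IsManifold (𝓡 3) ∞ X]
        [T2Space X] [SecondCountableTopology X] [ConnectedSpace X]
        (D : InitialDataSet (𝓡 3) X) (𝒟 : CauchyDevelopment D)
        (Φ' : Schwarzschild.isotropicExterior M → X)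
        (ψ : Schwarzschild.isotropicExterior M → Kerr.region 0 (Kerr.rPlus M 0)),
        (∀ y, (ψ y : E4) =
          E4.ofTimeSpace (2 * M * Real.log (‖(y : E3)‖ * (1 + M / (2 * ‖(y : E3)‖)) ^ 2 / (2 * M) - 1))
            ((1 + M / (2 * ‖(y : E3)‖)) ^ 2 • (y : E3))) →
        ∀ (χ : (Kerr.spacetime M 0 (Kerr.rPlus M 0) hM.le).carrier → 𝒟.carrier),
        ContMDiff (𝓡 4) (𝓡 4) ∞ χ → Topology.IsOpenEmbedding χ →
        (Kerr.spacetime M 0 (Kerr.rPlus M 0) hM.le).metric.IsIsometricImmersion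
          𝒟.metric.toPseudoRiemannianMetric χ →
        (Kerr.spacetime M 0 (Kerr.rPlus M 0) hM.le).timeOrientation.PreservesTimeOrientation χ
          𝒟.timeOrientation →
        χ ∘ ψ = 𝒟.embed ∘ Φ' →
        (∀ K : Set X, IsCompact K →
          ∃ R' : ℝ, ∀ y : Schwarzschild.isotropicExterior M, R' < ‖(y : E3)‖ → Φ' y ∉ K) →
        (∀ (p : ℕ → Kerr.region 0 (Kerr.rPlus M 0)) (r₁ r₂ : ℝ), 2 * M < r₁ →
          (∀ n, r₁ ≤ E4.spatialNorm (p n).1 ∧ E4.spatialNorm (p n).1 ≤ r₂) →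
          Tendsto (fun n ↦ staticTime M (p n).1) atTop atTop →
          ∀ z : 𝒟.carrier, ¬ Tendsto (fun n ↦ χ (p n)) atTop (𝓝 z)) →
        ∀ τ' : ℝ, T₀ + 1 < τ' →
          closure (χ '' (Φ '' {y | τ' ≤ y.1 0 ∧ excision M (y.1 0) + 1 ≤ E4.spatialNorm y.1})) ⊆
            Set.range χ :=
  -- LANDED: `Theorems/StarvedNecksHonestFixedRadiusSettlingStubFarSlabNoEscape.lean` (p123969)
  Summit.FinalStateConjecture.FinalStateConjecture.Theorems.StarvedNecks.SheetBurial.stub_farSlabNoEscape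

/-! ## §3 The composition (kernel-checked, no `sorry` of its own) -/

open Summit.FinalStateConjecture.FinalStateConjecture.Theorems.SwallowTheDatum.UniversalWitnessFamily
open Summit.FinalStateConjecture.FinalStateConjecture.Theorems.SwallowTheDatum.UniversalWitnessFamily.SheetLine
  (sheetBurial_of socketBag_of_socketBagDeep)

/-! ### §3.1 Region I: the honest `C⁴` decomposition and its no-escape certificate -/

/-- The identity of the Lorentz group, as a map, is the identity. -/
theorem lorentzGroup_one_apply (v : E4) : ((1 : lorentzGroup) : E4 ≃L[ℝ] E4) v = v := rfl

/-- The identity of the Lorentz group, as a continuous linear map, has operator norm `1`. -/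
theorem norm_lorentzGroup_one : ‖(((1 : lorentzGroup) : E4 ≃L[ℝ] E4) : E4 →L[ℝ] E4)‖ = 1 := by
  have : (((1 : lorentzGroup) : E4 ≃L[ℝ] E4) : E4 →L[ℝ] E4) = ContinuousLinearMap.id ℝ E4 := rfl
  rw [this]
  exact ContinuousLinearMap.norm_id

/-- **Region I carries an HONEST `C⁴` `N = 1` decomposition, with the no-escape certificate of its far flat slabs.**
In `Kerr.spacetime M 0 (2M)` with the static slice `Σ₀ = range ψ`: the region `O = J⁺(Σ₀) ∩ I⁻(charted)` carries the
decomposition of the landed `stub_regionOneDecomposition` read at `k = 4` (hole chart `holeMap M T₀`, flat chart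
`outMap M` on `{x⁰ > T₀ + 1, ‖x̃‖ > excision M x⁰}`), which lies in `honestCoreSet ∩ honestFarSet` at `R₀ = 100M`
(`stub_regionOneHoleClauses`, `stub_regionOneFlatClauses`, `stub_regionOneFarCloseness`), and whose far flat slabs do not escape along any isometric time-oriented open embedding of region I
into a Cauchy development over the sheet, granted properness of the sheet chart and no future accumulation
(`stub_farSlabNoEscape`). [cite: DafermosLuk2017, Conjecture 1 (b)–(c)] [cite: ONeill1983, Ch. 13] -/
theorem regionOneHonestDecomposition [Kerr.Facts] {M : ℝ} (hM : 0 < M) (ψ : Schwarzschild.isotropicExterior M → Kerr.region 0 (Kerr.rPlus M 0))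
    (hψ : ∀ y, (ψ y : E4) =
      E4.ofTimeSpace (2 * M * Real.log (‖(y : E3)‖ * (1 + M / (2 * ‖(y : E3)‖)) ^ 2 / (2 * M) - 1))
        ((1 + M / (2 * ‖(y : E3)‖)) ^ 2 • (y : E3))) :
    ∃ (O : Set (Kerr.region 0 (Kerr.rPlus M 0)))
      (dec : FinalStateDecomposition (Kerr.spacetime M 0 (Kerr.rPlus M 0) hM.le) O 4) (R₀ : ℝ),
      O = (Kerr.smoothMetric M 0 (Kerr.rPlus M 0)).causalFuture (ksTime hM.le) (Set.range ψ) ∩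
          (Kerr.smoothMetric M 0 (Kerr.rPlus M 0)).chronologicalPast (ksTime hM.le) dec.charted ∧
      dec ∈ honestCoreSet (Kerr.spacetime M 0 (Kerr.rPlus M 0) hM.le) O 4 R₀ ∧
      dec ∈ honestFarSet (Kerr.spacetime M 0 (Kerr.rPlus M 0) hM.le) O 4 R₀ ∧
      ∀ (X : Type) [TopologicalSpace X] [ChartedSpace E3 X] [IsManifold (𝓡 3) ∞ X]
        [T2Space X] [SecondCountableTopology X] [ConnectedSpace X]
        (D : InitialDataSet (𝓡 3) X) (𝒟 : CauchyDevelopment D)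
        (Φ' : Schwarzschild.isotropicExterior M → X)
        (χ : (Kerr.spacetime M 0 (Kerr.rPlus M 0) hM.le).carrier → 𝒟.carrier),
        ContMDiff (𝓡 4) (𝓡 4) ∞ χ → Topology.IsOpenEmbedding χ →
        (Kerr.spacetime M 0 (Kerr.rPlus M 0) hM.le).metric.IsIsometricImmersion
          𝒟.metric.toPseudoRiemannianMetric χ →
        (Kerr.spacetime M 0 (Kerr.rPlus M 0) hM.le).timeOrientation.PreservesTimeOrientation χ
          𝒟.timeOrientation →
        χ ∘ ψ = 𝒟.embed ∘ Φ' →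
        (∀ K : Set X, IsCompact K →
          ∃ R' : ℝ, ∀ y : Schwarzschild.isotropicExterior M, R' < ‖(y : E3)‖ → Φ' y ∉ K) →
        (∀ (p : ℕ → Kerr.region 0 (Kerr.rPlus M 0)) (r₁ r₂ : ℝ), 2 * M < r₁ →
          (∀ n, r₁ ≤ E4.spatialNorm (p n).1 ∧ E4.spatialNorm (p n).1 ≤ r₂) →
          Tendsto (fun n ↦ staticTime M (p n).1) atTop atTop →
          ∀ z : 𝒟.carrier, ¬ Tendsto (fun n ↦ χ (p n)) atTop (𝓝 z)) →
        ∀ τ' : ℝ, dec.τ₀ < τ' →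
          closure (χ '' (dec.flatChart '' {y | τ' ≤ y.1 0 ∧
            ∀ i, dec.excision i (y.1 0) + 1 ≤ (dec.background i).radius y.1})) ⊆ Set.range χ := by
  obtain ⟨T₀, -, hT0, hmono, htor⟩ := exists_lateTime hM
  obtain ⟨Θ, -, hΘs⟩ := exists_timeReflection
  -- the region `O = {t ≥ 0}`
  obtain ⟨O, hO⟩ : ∃ O : Set (Kerr.region 0 (Kerr.rPlus M 0)), O = {p | 0 ≤ staticTime M p.1} := ⟨_, rfl⟩
  have hJO : (Kerr.smoothMetric M 0 (Kerr.rPlus M 0)).causalFuture (ksTime hM.le) (Set.range ψ) = O := by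
    rw [hO]; exact causalFuture_range_sheet hM hψ
  -- the hole chart
  let Bh : ModelBackground := boostedKerrBackground 1 0 M 0
  let chart : Bh.domain → Kerr.region 0 (Kerr.rPlus M 0) :=
    fun y ↦ ⟨holeMap M T₀ y.1, holeMap_mem_region hM T₀ ((mem_holeDomain hM.le).1 y.2)⟩
  have hchart : ∀ y, (chart y : E4) = holeMap M T₀ y := fun _ ↦ rfl
  have hchart_late : chart '' Bh.lateRegion (T₀ + 1) ⊆ O := by
    rintro _ ⟨y, hy, rfl⟩
    have hy0 : T₀ + 1 < y.1 0 := mem_holeLateRegion.1 hy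
    have hyr : 2 * M < E4.spatialNorm y.1 := (mem_holeDomain hM.le).1 y.2
    rw [hO]
    show 0 ≤ staticTime M (holeMap M T₀ y.1)
    rw [holeMap_of_le M hy0.le, staticTime_bentMap]
    exact staticTime_bent_nonneg hM htor hT0.le (by linarith) hyr
  -- the flat chart
  let Ωf : TopologicalSpace.Opens E4 :=
    ⟨{x | 2 * M < E4.spatialNorm x}, isOpen_lt continuous_const (continuous_norm.comp E4.spatial.continuous)⟩
  have hΩf : ∀ x ∈ Ωf, 2 * M < E4.spatialNorm x := fun _ h ↦ h
  let Bf : ModelBackground := ⟨Ωf, fun x ↦ boostedKerrBilin Θ 0 M 0 x, fun x ↦ x 0, E4.spatialNorm⟩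
  let Φf : Bf.domain → Kerr.region 0 (Kerr.rPlus M 0) :=
    fun y ↦ ⟨outMap M y.1, outMap_mem_region hM (hΩf y.1 y.2)⟩
  have hΦf : ∀ y, (Φf y : E4) = outMap M y := fun _ ↦ rfl
  have hc0 : Continuous fun y : E4 ↦ y 0 := PiLp.continuous_apply 2 _ 0
  let U'' : TopologicalSpace.Opens E4 := ⟨{x | T₀ + 1 < x 0 ∧ excision M (x 0) < E4.spatialNorm x},
    (isOpen_lt continuous_const hc0).inter
      (isOpen_lt ((continuous_excision M).comp hc0) (continuous_norm.comp E4.spatial.continuous))⟩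
  have hU'' : ∀ x, x ∈ U'' ↔ T₀ + 1 < x 0 ∧ excision M (x 0) < E4.spatialNorm x := fun _ ↦ Iff.rfl
  have hU''4 : ∀ x ∈ U'', 4 * M < E4.spatialNorm x := fun x hx ↦ (four_mul_lt_excision hM (x 0)).trans hx.2
  have hle : (Minkowski.backgroundOn U'').domain ≤ Bf.domain := fun x hx ↦
    show 2 * M < E4.spatialNorm x by linarith [hU''4 x hx]
  let flat : (Minkowski.backgroundOn U'').domain → Kerr.region 0 (Kerr.rPlus M 0) :=
    Φf ∘ TopologicalSpace.Opens.inclusion hle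
  have hflat : ∀ y, (flat y : E4) = outMap M y := fun _ ↦ rfl
  have hflatΩ : ∀ x ∈ U'', 2 * M < E4.spatialNorm x := fun x hx ↦ hle hx
  have hflat_late : ∀ τ₁, T₀ + 1 ≤ τ₁ → flat '' (Minkowski.backgroundOn U'').lateRegion τ₁ ⊆ O := by
    rintro τ₁ hτ₁ _ ⟨y, hy, rfl⟩
    have hy1 : τ₁ < y.1 0 := hy
    rw [hO]
    show 0 ≤ staticTime M (outMap M y.1)
    have := le_staticTime_outMap hM (hU''4 y.1 y.2).le
    linarith
  -- vertical flows: `I⁻(hole late image) = everything`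
  have hflowI : ∀ p : Kerr.region 0 (Kerr.rPlus M 0),
      p ∈ (Kerr.smoothMetric M 0 (Kerr.rPlus M 0)).chronologicalPast (ksTime hM.le)
        (chart '' Bh.lateRegion (T₀ + 1)) := by
    intro p
    set f : ℝ := (T₀ + 1) + bend M (T₀ + 1) (E4.spatialNorm p.1) with hf
    set s : ℝ := max 1 (f - p.1 0 + 1) with hs
    have hs0 : 0 < s := lt_of_lt_of_le one_pos (le_max_left _ _)
    have hq : vert p s ∈ chart '' Bh.lateRegion (T₀ + 1) := by
      rw [image_holeChart_lateRegion chart hchart hM hmono]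
      show (T₀ + 1) + bend M (T₀ + 1) (E4.spatialNorm (vert p s).1) < (vert p s).1 0
      rw [spatialNorm_vert, vert_apply_zero, ← hf]
      have := le_max_right 1 (f - p.1 0 + 1)
      linarith
    exact LorentzianMetric.chronologicalFuture_mono (singleton_subset_iff.2 hq) (mem_chronologicalPast_vert hM p hs0)
  -- the decomposition (verbatim the landed one, read at `k = 4`)
  let d : FinalStateDecomposition (Kerr.spacetime M 0 (Kerr.rPlus M 0) hM.le) O 4 :=
    { N := 1
      mass := fun _ ↦ M
      spin := fun _ ↦ 0
      mass_pos := fun _ ↦ hM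
      abs_spin_le_mass := fun _ ↦ by rw [abs_zero]; exact hM.le
      motion := fun _ ↦ (1, 0)
      τ₀ := T₀ + 1
      chart := fun _ ↦ chart
      isLateChart := fun _ ↦ ⟨contMDiff_holeChart chart hchart hM,
        isOpenEmbedding_restrict_holeChart chart hchart hM hmono, hchart_late⟩
      tendsto_truncDeviationCk := fun _ R ↦ tendsto_truncDeviationCk_holeChart chart hchart hM 4
        ((tendsto_exactRadius_atTop hM).eventually_gt_atTop R)
      exists_pairwise_disjoint := fun _ ↦ ⟨0, Subsingleton.pairwise⟩
      excision := fun _ ↦ excision M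
      tendsto_excision_div := fun _ ↦ tendsto_excision_div_atTop hM
      flatDomain := U''
      setOf_lt_excision_subset_flatDomain := fun x hx ↦ ⟨hx.1, by
        have := hx.2 0
        rwa [poincareInv_one_zero, Kerr.radius_zero_left] at this⟩
      flatChart := flat
      isLateChart_flat := ⟨(contMDiff_outChart hM hΩf Φf hΦf).comp (contMDiff_inclusion hle),
        isOpenEmbedding_restrict_outChart hM hflatΩ flat hflat
          (isOpen_lt continuous_const (hc0.comp continuous_subtype_val)),
        hflat_late (T₀ + 1) le_rfl⟩
      tendsto_deviationCk_flat := tendsto_deviationCk_outChart hM hΘs Bf rfl (fun _ ↦ rfl) (fun _ ↦ rfl) hΩf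
        Φf hΦf 4 (tendsto_excision_atTop hM) (W := U'') (fun z hz ↦ hz.2) hle
      diff_subset_causalPast := by
        intro p hp
        have hp2 : p ∉ chart '' Bh.lateRegion (T₀ + 1) := fun h ↦
          hp.2 (Or.inl (Set.mem_iUnion.mpr ⟨0, h⟩))
        rw [image_holeChart_lateRegion chart hchart hM hmono] at hp2
        have hle' : p.1 0 ≤ (T₀ + 1) + bend M (T₀ + 1) (E4.spatialNorm p.1) := le_of_not_gt hp2
        have hq : vert p ((T₀ + 1) + bend M (T₀ + 1) (E4.spatialNorm p.1) - p.1 0) ∈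
            chart '' Bh.timeSlab (T₀ + 1) := by
          rw [image_holeChart_timeSlab chart hchart hM le_rfl]
          show (vert p _).1 0 = (T₀ + 1) + bend M (T₀ + 1) (E4.spatialNorm (vert p _).1)
          rw [spatialNorm_vert, vert_apply_zero]; ring
        refine LorentzianMetric.causalFuture_mono ?_ (mem_causalPast_vert hM p (sub_nonneg.2 hle'))
        exact singleton_subset_iff.2 (Or.inl (Set.mem_iUnion.mpr ⟨0, hq⟩)) }
  -- the radius of the (only) hole background, read on the flat coordinates, is `‖ỹ‖`
  have hfarset : ∀ τ' : ℝ, {y : d.flatDomain | τ' ≤ y.1 0 ∧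
      ∀ i, d.excision i (y.1 0) + 1 ≤ (d.background i).radius y.1} =
      {y : (Minkowski.backgroundOn U'').domain | τ' ≤ y.1 0 ∧ excision M (y.1 0) + 1 ≤ E4.spatialNorm y.1} := by
    intro τ'
    ext y
    simp only [Set.mem_setOf_eq]
    constructor
    · rintro ⟨h1, h2⟩
      refine ⟨h1, ?_⟩
      have := h2 0
      rwa [show (d.background 0).radius y.1 = E4.spatialNorm y.1 from holeBackground_radius M y.1] at this
    · rintro ⟨h1, h2⟩
      refine ⟨h1, fun i ↦ ?_⟩
      rwa [show (d.background i).radius y.1 = E4.spatialNorm y.1 from holeBackground_radius M y.1]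
  -- the three packages of honest clauses
  obtain ⟨hC2, hC3⟩ := stub_regionOneHoleClauses M hM T₀ hmono chart hchart
  obtain ⟨hC4, hF1, hF2⟩ := stub_regionOneFlatClauses M hM T₀ hT0.le U'' hU'' flat hflat
  obtain ⟨T, hT⟩ := stub_regionOneFarCloseness M hM T₀ chart hchart
  refine ⟨O, d, 100 * M, ?_, ?_, ?_, ?_⟩
  · -- `O = J⁺(Σ₀) ∩ I⁻(charted)`
    rw [hJO]
    refine Set.Subset.antisymm (fun p hp ↦ ⟨hp, ?_⟩) inter_subset_left
    refine LorentzianMetric.chronologicalFuture_mono ?_ (hflowI p)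
    exact (Set.subset_iUnion (fun i : Fin 1 ↦ d.chart i '' (d.background i).lateRegion d.τ₀) 0).trans
      subset_union_right
  · -- HonestCore
    refine ⟨fun _ ↦ ⟨?_, le_rfl, ?_⟩, fun _ ϱ τ₂ _ hτ₂ ↦ hC2 ϱ τ₂ hτ₂,
      fun _ τ' ϱ hϱ hτ' ↦ ?_, fun y hy ↦ hC4 y hy⟩
    · show |(0 : ℝ)| < M
      rw [abs_zero]; exact hM
    · show (0 : ℝ) < ((1 : lorentzGroup) : E4 ≃L[ℝ] E4) (E4.basisVector 0) 0
      rw [lorentzGroup_one_apply]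
      simp [E4.basisVector]
    · intro A p hp
      exact hC3 τ' ϱ hϱ hτ' hp.1
  · -- HonestFar
    refine ⟨fun τ₂ hτ₂ ↦ hF1 τ₂ hτ₂, fun τ' hτ' ↦ ?_, fun _ ↦ ?_⟩
    · exact (closure_mono (Set.image_mono (hfarset τ').subset)).trans (hF2 τ' hτ')
    · refine ⟨T, ?_⟩
      rw [norm_lorentzGroup_one, one_pow, mul_one]
      refine le_trans (supCkENorm_mono (Set.image_mono ?_) _ _) hT
      intro x hx
      exact ⟨hx.1, hx.2.1⟩
  · -- no escape of the far flat slabs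
    intro X _ _ _ _ _ _ D 𝒟 Φ' χ hχ hχo hiso hτ hcomm hproper hnoacc τ' hτ'
    exact (closure_mono (Set.image_mono (Set.image_mono (hfarset τ').subset))).trans
      (stub_farSlabNoEscape M hM T₀ hT0.le U'' hU'' flat hflat X D 𝒟 Φ' ψ hψ χ hχ hχo hiso hτ hcomm hproper hnoacc τ' hτ')

/-! ### §3.2 Transport into a development into which region I embeds over the sheet -/

/-- The static slice maps into the Cauchy hypersurface: `χ({t = 0}) = χ(range ψ) = ι(Φ'(sheet)) ⊆ range ι`. -/
theorem image_staticSlice_subset [Kerr.Facts] {M : ℝ} (hM : 0 < M)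
    {ψ : Schwarzschild.isotropicExterior M → Kerr.region 0 (Kerr.rPlus M 0)}
    (hψ : ∀ y, (ψ y : E4) =
      E4.ofTimeSpace (2 * M * Real.log (‖(y : E3)‖ * (1 + M / (2 * ‖(y : E3)‖)) ^ 2 / (2 * M) - 1))
        ((1 + M / (2 * ‖(y : E3)‖)) ^ 2 • (y : E3)))
    {X : Type} [TopologicalSpace X] [ChartedSpace E3 X] [IsManifold (𝓡 3) ∞ X] [ConnectedSpace X]
    {D : InitialDataSet (𝓡 3) X} (𝒟 : CauchyDevelopment D) {Φ' : Schwarzschild.isotropicExterior M → X}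
    {χ : (Kerr.spacetime M 0 (Kerr.rPlus M 0) hM.le).carrier → 𝒟.carrier} (hcomm : χ ∘ ψ = 𝒟.embed ∘ Φ') :
    χ '' {p : (Kerr.spacetime M 0 (Kerr.rPlus M 0) hM.le).carrier | staticTime M p.1 = 0} ⊆
      Set.range 𝒟.embed := by
  rintro _ ⟨p, hp, rfl⟩
  have hp' : (p : Kerr.region 0 (Kerr.rPlus M 0)) ∈ Set.range ψ := by
    rw [range_sheet_eq hM hψ]; exact hp
  obtain ⟨y, hy⟩ := hp'
  exact ⟨Φ' y, by rw [← hy]; exact (congrFun hcomm y).symm⟩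

/-- **Core of the transport, for the open-sheet datum as a VARIABLE `D₀`** (verbatim the landed `settles_core`, with
the honest `C⁴` decomposition of region I in place of the exhaustive `C²` one): complete `𝓘⁺` and an HONEST `C⁴`
decomposition of the self-determined exterior of `𝒟`, from the specialisations to `Φ'` of `SubdataDevelopmentsEmbed`,
of `stub_exteriorTransport`, of the scri lever, from properness of `Φ'`, and from the landed stubs 2–7.
[cite: DafermosLuk2017, Conjecture 1] [cite: Christodoulou1999, p. A24] -/
theorem settlesHonestly_core [Kerr.Facts] {X : Type} [TopologicalSpace X] [ChartedSpace E3 X] [IsManifold (𝓡 3) ∞ X]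
    [T2Space X] [SecondCountableTopology X] [ConnectedSpace X]
    {D : InitialDataSet (𝓡 3) X} (𝒟 : VacuumCauchyDevelopment D)
    {M : ℝ} (hM : 0 < M) {Φ' : Schwarzschild.isotropicExterior M → X}
    (hopen : Topology.IsOpenEmbedding Φ')
    (hfar : ∀ R' : ℝ, M / 2 ≤ R' →
      IsCompact (Φ' '' {y : Schwarzschild.isotropicExterior M | R' < ‖(y : E3)‖})ᶜ)
    (hproper : ∀ K : Set X, IsCompact K →
      ∃ R' : ℝ, ∀ y : Schwarzschild.isotropicExterior M, R' < ‖(y : E3)‖ → Φ' y ∉ K)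
    {D₀ : InitialDataSet (𝓡 3) (Schwarzschild.isotropicExterior M)}
    (hdata : D₀ = Schwarzschild.timeSymmetricExteriorData M hM.le)
    (hEspec : ∀ 𝒟' : VacuumCauchyDevelopment D₀, ∃ χ : 𝒟'.carrier → 𝒟.carrier,
      ContMDiff (𝓡 4) (𝓡 4) ∞ χ ∧ Topology.IsOpenEmbedding χ ∧
        𝒟'.metric.IsIsometricImmersion 𝒟.metric.toPseudoRiemannianMetric χ ∧
          𝒟'.timeOrientation.PreservesTimeOrientation χ 𝒟.timeOrientation ∧
            χ ∘ 𝒟'.embed = 𝒟.embed ∘ Φ')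
    (hT1spec : ∀ (𝒦 : CauchyDevelopment D₀) (χ : 𝒦.carrier → 𝒟.carrier),
      ContMDiff (𝓡 4) (𝓡 4) ∞ χ → Topology.IsOpenEmbedding χ →
      𝒦.metric.IsIsometricImmersion 𝒟.metric.toPseudoRiemannianMetric χ →
      𝒦.timeOrientation.PreservesTimeOrientation χ 𝒟.timeOrientation →
      χ ∘ 𝒦.embed = 𝒟.embed ∘ Φ' →
      ∀ C : Set 𝒦.carrier,
        Summit.FinalStateConjecture.exteriorOf 𝒟.toCauchyDevelopment (χ '' C) =
          χ '' Summit.FinalStateConjecture.exteriorOf 𝒦 C)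
    (hSTspec : ∀ (𝒮 : DataEmbedding D₀) (χ : 𝒮.carrier → 𝒟.carrier),
      ContMDiff (𝓡 4) (𝓡 4) ∞ χ → Topology.IsOpenEmbedding χ →
      𝒮.metric.IsIsometricImmersion 𝒟.metric.toPseudoRiemannianMetric χ →
      𝒮.timeOrientation.PreservesTimeOrientation χ 𝒟.timeOrientation →
      χ ∘ 𝒮.embed = 𝒟.embed ∘ Φ' →
      ∀ (K : Set X), IsCompact K → Kᶜ ⊆ Set.range Φ' →
      (∀ [𝒮.metric.HasLeviCivita],
        ∃ K₀ : Set X, IsCompact K₀ ∧ ∀ s : ℝ, 0 < s → ∃ K₁ : Set X, IsCompact K₁ ∧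
          ∀ p : Schwarzschild.isotropicExterior M, Φ' p ∉ K₁ → ∀ (γ : ℝ → 𝒮.carrier) (dom : Set ℝ),
            𝒮.metric.IsNormalisedNullRayFrom 𝒮.timeOrientation 𝒮.embed 𝒮.normal p γ dom →
            ¬ BddAbove dom ∨ ENNReal.ofReal s ≤ sojournTime γ dom
              (𝒮.metric.causalFuture 𝒮.timeOrientation (𝒮.embed '' (Φ' ⁻¹' K₀)))) →
      Summit.FinalStateConjecture.HasCompleteNullInfinity 𝒟.toCauchyDevelopment) :
    Summit.FinalStateConjecture.HasCompleteNullInfinity 𝒟.toCauchyDevelopment ∧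
      ∃ (O : Set 𝒟.carrier) (dec : FinalStateDecomposition 𝒟.toSpacetime O 4) (R₀ : ℝ),
        O = Summit.FinalStateConjecture.exteriorOf 𝒟.toCauchyDevelopment dec.charted ∧
          dec ∈ honestCoreSet 𝒟.toSpacetime O 4 R₀ ∧ dec ∈ honestFarSet 𝒟.toSpacetime O 4 R₀ := by
  subst hdata
  -- the explicit region-I development of the open-sheet datum (verbatim `settles_core`)
  let ψ : Schwarzschild.isotropicExterior M → Kerr.region 0 (Kerr.rPlus M 0) := fun y ↦
    ⟨E4.ofTimeSpace (2 * M * Real.log (‖(y : E3)‖ * (1 + M / (2 * ‖(y : E3)‖)) ^ 2 / (2 * M) - 1))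
        ((1 + M / (2 * ‖(y : E3)‖)) ^ 2 • (y : E3)),
      ThroatSettlesToo.sheetPoint_mem hM y⟩
  let ν : NormalField 𝓘(ℝ, E4) ψ := fun y ↦
    (Real.sqrt (1 - 2 * M / (‖(y : E3)‖ * (1 + M / (2 * ‖(y : E3)‖)) ^ 2)))⁻¹ • E4.basisVector 0
  have hψ : ∀ y, (ψ y : E4) =
      E4.ofTimeSpace (2 * M * Real.log (‖(y : E3)‖ * (1 + M / (2 * ‖(y : E3)‖)) ^ 2 / (2 * M) - 1))
        ((1 + M / (2 * ‖(y : E3)‖)) ^ 2 • (y : E3)) := fun y ↦ rfl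
  have hν : ∀ y, ν y = (Real.sqrt (1 - 2 * M / (‖(y : E3)‖ * (1 + M / (2 * ‖(y : E3)‖)) ^ 2)))⁻¹ •
      E4.basisVector 0 := fun y ↦ rfl
  obtain ⟨hemb, hunit, hh, hk⟩ := stub_sheetDataEmbedding M hM ψ ν hψ hν
  have hcauchy := stub_sheetCauchy M hM ψ hψ
  let 𝒦₀ : VacuumCauchyDevelopment (Schwarzschild.timeSymmetricExteriorData M hM.le) :=
    { toSpacetime := Kerr.spacetime M 0 (Kerr.rPlus M 0) hM.le
      embed := ψ
      isSmoothEmbedding := hemb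
      normal := ν
      isFutureUnitNormal := hunit
      induced_h := hh
      induced_k := by
        intro inst y
        haveI : (Kerr.smoothMetric M 0 (Kerr.rPlus M 0)).toPseudoRiemannianMetric.HasLeviCivita := inst
        exact hk y
      isCauchyHypersurface := hcauchy
      isRicciFlat := by
        intro inst
        haveI : (Kerr.smoothMetric M 0 (Kerr.rPlus M 0)).toPseudoRiemannianMetric.HasLeviCivita := inst
        exact Kerr.isRicciFlat_smoothMetric_zero_spin M (Kerr.rPlus M 0) }
  -- exterior ignorance: 𝒦₀ embeds into 𝒟 over Φ'
  obtain ⟨χ, hχ, hχo, hiso, hτ, hcomm⟩ := hEspec 𝒦₀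
  refine ⟨?_, ?_⟩
  · -- scri: the relative certificate of region I rides along χ (landed lever), verbatim `settles_core`
    refine hSTspec 𝒦₀.toDataEmbedding χ hχ hχo hiso hτ hcomm
      (Φ' '' {y : Schwarzschild.isotropicExterior M | M / 2 + 1 < ‖(y : E3)‖})ᶜ
      (hfar (M / 2 + 1) (by linarith)) (fun x hx ↦ ?_) ?_
    · simp only [Set.mem_compl_iff, not_not] at hx
      obtain ⟨y, -, rfl⟩ := hx
      exact ⟨y, rfl⟩
    · intro _inst
      haveI : (Kerr.smoothMetric M 0 (Kerr.rPlus M 0)).toPseudoRiemannianMetric.HasLeviCivita := _inst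
      obtain ⟨R₀, hR₀, hs⟩ := stub_regionOneScri M hM ψ ν hψ hν
      set A₀ : Set (Schwarzschild.isotropicExterior M) :=
        {y | R₀ ≤ ‖(y : E3)‖ ∧ ‖(y : E3)‖ ≤ R₀ + 1} with hA₀
      have hA₀c : IsCompact A₀ := by
        rw [Subtype.isCompact_iff]
        have hS : (Subtype.val '' A₀ : Set E3) = {z : E3 | R₀ ≤ ‖z‖ ∧ ‖z‖ ≤ R₀ + 1} := by
          ext z
          simp only [Set.mem_image, Set.mem_setOf_eq, hA₀]
          constructor
          · rintro ⟨y, hy, rfl⟩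
            exact hy
          · intro hz
            have hzM : M / 2 < ‖z‖ := lt_of_lt_of_le hR₀ hz.1
            exact ⟨⟨z, hzM⟩, hz, rfl⟩
        rw [hS]
        have hsub : {z : E3 | R₀ ≤ ‖z‖ ∧ ‖z‖ ≤ R₀ + 1} ⊆ Metric.closedBall (0 : E3) (R₀ + 1) := by
          intro z hz
          rw [Metric.mem_closedBall, dist_zero_right]
          exact hz.2
        refine (isCompact_closedBall (0 : E3) (R₀ + 1)).of_isClosed_subset ?_ hsub
        exact (isClosed_le continuous_const continuous_norm).inter
          (isClosed_le continuous_norm continuous_const)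
      refine ⟨Φ' '' A₀, hA₀c.image hopen.continuous, fun s hs0 ↦ ?_⟩
      obtain ⟨R₁, hR₁⟩ := hs s hs0
      refine ⟨(Φ' '' {y : Schwarzschild.isotropicExterior M | max R₁ (M / 2) < ‖(y : E3)‖})ᶜ,
        hfar _ (le_max_right _ _), fun p hp γ dom hγ ↦ ?_⟩
      have hpR : R₁ < ‖(p : E3)‖ := by
        simp only [Set.mem_compl_iff, not_not] at hp
        obtain ⟨y, hy, hyp⟩ := hp
        have : y = p := hopen.injective hyp
        subst this
        exact lt_of_le_of_lt (le_max_left _ _) hy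
      have hpre : Φ' ⁻¹' (Φ' '' A₀) = A₀ := hopen.injective.preimage_image A₀
      have key := hR₁ p hpR γ dom hγ
      rw [hpre]
      exact key
  · -- decomposition: the honest region-I decomposition, pushed forward along χ
    obtain ⟨O₀, dec₀, R₀, hO₀, hc₀, hf₀, hnoesc₀⟩ := regionOneHonestDecomposition hM ψ hψ
    have hslice := image_staticSlice_subset hM hψ 𝒟.toCauchyDevelopment hcomm
    have hnoacc := stub_noFutureAccumulation M hM X D 𝒟.toCauchyDevelopment χ hχ hχo hiso hτ hslice
    have hne := hnoesc₀ X D 𝒟.toCauchyDevelopment Φ' χ hχ hχo hiso hτ hcomm hproper hnoacc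
    obtain ⟨dec', hch', hc', hf'⟩ :=
      stub_honestPushforward 𝒦₀.toSpacetime 𝒟.toSpacetime χ hχ hχo hiso hτ O₀ 4 dec₀ R₀ hc₀ hf₀ hne
    refine ⟨χ '' O₀, dec', R₀, ?_, hc', hf'⟩
    have h1 := hT1spec 𝒦₀.toCauchyDevelopment χ hχ hχo hiso hτ hcomm dec₀.charted
    rw [hch', h1]
    exact congrArg (fun S ↦ χ '' S) hO₀

/-- **Complete `𝓘⁺` and an HONEST `C⁴` decomposition in every MAXIMAL development of a sheet-shielded datum**:
`𝒟 ∈ honestDevelopments D` — from `SubdataDevelopmentsEmbed` (route item 10053) specialised to the sheet chart, the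
landed levers `stub_exteriorTransport` / `stub_scriTransfer`, properness of the sheet chart (stub 1) and
`settlesHonestly_core` (stubs 2–7, landed). [cite: DafermosLuk2017, Conjecture 1] -/
theorem mem_honestDevelopments_ofSheet (hE : SubdataDevelopmentsEmbed)
    (X : Type) [TopologicalSpace X] [ChartedSpace E3 X] [IsManifold (𝓡 3) ∞ X]
    [T2Space X] [SecondCountableTopology X] [ConnectedSpace X]
    (D : InitialDataSet (𝓡 3) X)
    (hsh : ∃ (M' : ℝ) (hM' : 0 < M') (Φ : Schwarzschild.isotropicExterior M' → X)
      (hΦ : ContMDiff (𝓡 3) (𝓡 3) (∞ + 1) Φ) (hΦ' : ∀ u, Function.Injective (mfderiv (𝓡 3) (𝓡 3) Φ u)),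
      Topology.IsOpenEmbedding Φ ∧
      (∀ R' : ℝ, M' / 2 ≤ R' →
        IsCompact (Φ '' {y : Schwarzschild.isotropicExterior M' | R' < ‖(y : E3)‖})ᶜ) ∧
      D.comap Φ hΦ hΦ' = Schwarzschild.timeSymmetricExteriorData M' hM'.le)
    (𝒟 : VacuumCauchyDevelopment D) (hmax : 𝒟.IsMaximal) :
    𝒟 ∈ honestDevelopments D := by
  haveI : Kerr.Facts :=
    ⟨Kerr.isConnected_region_holds, Kerr.contMDiff_bilin_holds, Kerr.contMDiff_timeVector_holds⟩
  obtain ⟨M, hM, Φ', hΦ', hΦ'', hopen, hfar, hdata⟩ := hsh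
  have hproper := stub_sheetProper X D M hM Φ' hΦ' hΦ'' hopen hdata
  exact settlesHonestly_core 𝒟 hM hopen hfar hproper hdata
    (hE X D 𝒟 hmax (Schwarzschild.isotropicExterior M) Φ' hΦ' hΦ'' hopen)
    (stub_exteriorTransport X D 𝒟.toCauchyDevelopment (Schwarzschild.isotropicExterior M) Φ' hΦ' hΦ'' hopen)
    (Summit.FinalStateConjecture.FinalStateConjecture.Theorems.PhaseMixingCapture.WeakCosmicCensorshipMGHD.stub_scriTransfer
      X D 𝒟.toCauchyDevelopment (Schwarzschild.isotropicExterior M) Φ' hΦ' hΦ'' hopen)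

/-! ### §3.3 The crux -/

/-- **Skeleton theorem (reshape v6).**  The four EXISTING SwallowTheDatum items — `FarAnnulusGluing` (15427),
`UniversalSocketBag` (15426), `MGHDExists` (9937), `SubdataDevelopmentsEmbed` (10053), all BY NAME — imply the crux
`StarvedNecks.HonestFixedRadiusSettling` BY NAME (the seven registered stubs are LANDED and discharged inside): through an exceptional admissible `d`
passes the SHEET-BURIAL family of the landed `sheetBurial_of` (far gluing + the open-sheet bag
`socketBag_of_socketBagDeep` + the landed `stub_socketDilation` / `stub_socketTransportPatch` / `stub_sheetBreathing`);
its members are admissible and, for `c ≠ 0`, sheet-shielded, hence in `settlingSet X` (`MGHDExists` for the ∃-MGHD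
conjunct, `mem_honestDevelopments_ofSheet` for the ∀-MGHD conjunct) — Christodoulou codimension `1`
(`Negative.crux_iff`). [cite: Christodoulou1999, p. A24] [cite: DafermosLuk2017, Conjecture 1] -/
theorem HonestFixedRadiusSettling_of (hA : FarAnnulusGluing) (hU : UniversalSocketBag) (hMGHD : MGHDExists)
    (hE : SubdataDevelopmentsEmbed) : HonestFixedRadiusSettling := by
  rw [crux_iff]
  intro X _ _ _ _ _ _ d hd
  obtain ⟨hdadm, -⟩ := hd
  obtain ⟨F, hF, h0, hinj, hadm, hsh⟩ :=
    sheetBurial_of hA (socketBag_of_socketBagDeep hU)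
      Summit.FinalStateConjecture.FinalStateConjecture.Theorems.SwallowTheDatum.UniversalWitnessFamily.stub_socketDilation
      Summit.FinalStateConjecture.FinalStateConjecture.Theorems.SwallowTheDatum.UniversalWitnessFamily.stub_socketTransportPatch
      Summit.FinalStateConjecture.FinalStateConjecture.Theorems.SwallowTheDatum.UniversalWitnessFamily.stub_sheetBreathing
      X d hdadm
  refine ⟨F, hF, h0, hinj, hadm, fun c hc hcE ↦ hcE.2 ?_⟩
  exact ⟨hMGHD X (F c) (hadm c), fun 𝒟 h𝒟 ↦
    mem_honestDevelopments_ofSheet hE X (F c) (hsh c hc) 𝒟 h𝒟⟩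

/-- Wiring check: the four SwallowTheDatum items (BY NAME) feed `HonestFixedRadiusSettling_of`; the seven stubs are the landed
tree theorems, discharged inside. -/
example (hA : FarAnnulusGluing) (hU : UniversalSocketBag) (hMGHD : MGHDExists) (hE : SubdataDevelopmentsEmbed) :
    HonestFixedRadiusSettling :=
  HonestFixedRadiusSettling_of hA hU hMGHD hE

end Summit.FinalStateConjecture.FinalStateConjecture.Cruxes.HonestFixedRadiusSettling.SheetBurial

end
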